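import Mathlib
import Literature.AlgebraicGeometry.Motives.FamiliesVHS
import Literature.AlgebraicGeometry.HodgeTheory.AlgebraicClasses
import Literature.AlgebraicGeometry.HodgeTheory.GysinFormalism
import HarnessLib

/-!
# A class dying on the good fibres of a pencil with constant `R^{2q-1}` dies on their union
(Leray over an affine curve + weights)

Topic `Literature/AlgebraicGeometry/HodgeTheory`. One NAMED FACT (D-0014),
`pencil_restrictCompl_eq_zero_of_forall_fiber_eq_zero`, recording the following consequence of the
Leray spectral sequence and of Deligne's mixed Hodge theory. Let `X` be a smooth projective complex
`n`-fold, `φ : X → ℙ¹` a morphism whose fibres `X_t` over the complex points off a NON-EMPTY proper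
Zariski-closed `S ⊊ ℙ¹` are smooth projective `(n-1)`-folds, such that for those `t` the restriction
`H^{2q-1}(X(ℂ); ℂ) → H^{2q-1}(X_t(ℂ); ℂ)` is SURJECTIVE (so that over the affine curve
`V = ℙ¹ ∖ S` the local system `R^{2q-1}φ_*ℚ` is a quotient of a constant system by a flat — hence
constant — sub-system, i.e. a CONSTANT variation of Hodge structure; for a pencil of hyperplane
sections this is the Lefschetz hyperplane theorem in the range `2q - 1 < n - 1`). Then every class
`δ ∈ H^{2q}(X(ℂ); ℂ)` whose restriction to every fibre `X_t`, `t ∉ S`, vanishes restricts to zero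
on the open set `X_V = φ⁻¹(V)`.

Printed proof. (1) `X_V → V` is a proper submersion over the affine curve `V(ℂ)` (a non-compact
Riemann surface, of cohomological dimension `1` for local systems), so in the Leray spectral
sequence `E₂^{a,b} = Hᵃ(V, Rᵇφ_*ℚ) ⇒ H^{a+b}(X_V, ℚ)` (Voisin II Thm. 4.11) only the columns
`a = 0, 1` are non-zero and `E₂ = E_∞`; the Leray filtration of `H^{2q}(X_V)` is
`0 ⊆ L¹ = H¹(V, R^{2q-1}) ⊆ H^{2q}(X_V)` with quotient `H⁰(V, R^{2q})`, and `δ|_{X_V} ∈ L¹` because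
its image `t ↦ δ|_{X_t}` in `H⁰(V, R^{2q})` vanishes. (2) `R^{2q-1}φ_*ℚ|_V ≅ A_V` is constant, so by
the multiplicativity of the Leray spectral sequence (Voisin II Lemma 4.13) `L¹` is spanned by the
cup products `φ^*u ∪ b`, `u ∈ H¹(V(ℂ); ℚ)`, `b ∈ H^{2q-1}(X_V; ℚ)`
(`H¹(V) ⊗ H⁰(V, A) → H¹(V, A)` is onto). (3) In Deligne's mixed Hodge structures (Hodge II
Thm. 3.2.5; Voisin II §4.3.3: `W₀Hᵏ(U) = Im Hᵏ(X̄)` in Voisin's normalisation, i.e.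
`W_k Hᵏ(U) = Im Hᵏ(X̄)`, Hodge II Cor. 3.2.17) the class `δ|_{X_V}` has weight `≤ 2q` (it comes
from `X`), `H¹(V)` is pure of weight `2` (`W₁ H¹(V) = Im H¹(ℙ¹) = 0`), `H^{2q-1}(X_V)` has weights
`≥ 2q - 1`, and the cup product is a morphism of mixed Hodge structures (Deligne, Hodge II–III,
functoriality and compatibility with Künneth/cup products of the mixed Hodge structure), so `L¹`
has weights `≥ 2q + 1`; by strictness (Hodge II Thm. 2.3.5; Voisin II Thm. 4.20)
`L¹ ∩ W_{2q} H^{2q}(X_V) = 0`, whence `δ|_{X_V} = 0`. (Equivalently: the Leray spectral sequence of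
`X_V → V` is a spectral sequence of mixed Hodge structures — Zucker 1979 for families over curves,
Arapura 2005 in general — and `H¹(V, A) = H¹(V) ⊗ A` is pure of weight `2q + 1`.)
Sharpness: FALSE for `S = ∅` (over the whole `ℙ¹` the `L²` term `H²(ℙ¹, R^{2q-2})` survives:
`[X_t] ∪ h^{q-1}` dies on every fibre) and FALSE without the surjectivity hypothesis (for
`E × Y → ℙ¹` through an elliptic surface `E → ℙ¹` with `p_g > 0`, the transcendental classes of
`E` times `H^{2q-2}(Y)` die on every fibre but not on `X_V`).

Vocabulary: the tree's `Motives.fiberOver` / `Motives.fiberι`, `complexBetti`, `complexBetti.map`,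
`complexBetti.restrictCompl`; nothing is redefined. Consumer: the Lefschetz climb below the middle
degree (`Summits/HodgeConjecture/HodgeConjecture/Cruxes/VerticalSupportBelowMiddle/Lines/Sketch.lean`,
stub `stub_vsbm_glue`). Not here: the Leray spectral sequence, mixed Hodge structures on open
varieties, cup-product compatibility (none has a carrier in Mathlib or the tree).

## References

* [VoisinHodgeII2003] C. Voisin, Hodge Theory and Complex Algebraic Geometry II (2003), Thm. 4.11,
  Lemma 4.13, Thm. 4.15, §4.3.3 (Prop. 4.23, Thm. 4.24), Thm. 4.20.
* [DeligneHodgeII1971] P. Deligne, Théorie de Hodge II (1971), Thm. 2.3.5, Thm. 3.2.5, Cor. 3.2.17.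
* [DeligneHodgeIII1974] P. Deligne, Théorie de Hodge III (1974), §8.2.
* [Zucker1979] S. Zucker, Hodge theory with degenerating coefficients, Ann. of Math. 109 (1979).
* [Arapura2005] D. Arapura, The Leray spectral sequence is motivic, Invent. Math. 160 (2005), main theorem.
* [PetersSteenbrink2008] C. Peters, J. Steenbrink, Mixed Hodge Structures (2008), Part II (mixed Hodge
  structures on the cohomology of varieties and of families).
-/

noncomputable section

open CategoryTheory AlgebraicGeometry

namespace Literature.AlgebraicGeometry.HodgeTheory

section HodgeTheory

open Literature.AlgebraicGeometry.Motives

/-- **A class dying on the good fibres of a pencil with constant `R^{2q-1}` dies on their union**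
(named fact; Leray spectral sequence over an affine curve + Deligne's weights). Let `X` be a smooth
projective complex `n`-fold, `φ : X → ℙ¹` a morphism, `S ⊊ ℙ¹` a NON-EMPTY proper Zariski-closed
subset such that the fibre `X_t = fiberOver φ t` over every complex point `t ∉ S` is a smooth
projective `(n-1)`-fold and the restriction `H^{2q-1}(X(ℂ); ℂ) → H^{2q-1}(X_t(ℂ); ℂ)` is surjective
(so that `R^{2q-1}φ_*ℚ` is a constant variation of Hodge structure over `V = ℙ¹ ∖ S`). Then a class
`δ ∈ H^{2q}(X(ℂ); ℂ)` with `δ|_{X_t} = 0` for all complex `t ∉ S` restricts to `0` on the complex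
points of `φ⁻¹(V)`: `δ|_{φ⁻¹V}` lies in the Leray piece `L¹ = H¹(V, R^{2q-1}) = H¹(V) ⊗ A`
(two-column Leray spectral sequence over the affine curve `V`, Voisin II Thm. 4.11 / Lemma 4.13),
which is a mixed Hodge structure of weights `≥ 2q + 1` (`H¹(V)` pure of weight `2` as
`H¹(ℙ¹) = 0`; Hodge II Cor. 3.2.17 and the compatibility of the mixed Hodge structure with cup
products; equivalently the Leray spectral sequence is one of mixed Hodge structures, Zucker 1979 /
Arapura 2005), while `δ|` has weight `≤ 2q` (image of `H^{2q}(X)`, Voisin II §4.3.3); strictness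
(Hodge II Thm. 2.3.5, Voisin II Thm. 4.20) gives `δ| = 0`. FALSE for `S = ∅` and without the
surjectivity hypothesis (module docstring).
[cite: VoisinHodgeII2003, Thm. 4.11, Lemma 4.13, §4.3.3 and Thm. 4.20]
[cite: DeligneHodgeII1971, Thm. 2.3.5, Thm. 3.2.5 and Cor. 3.2.17]
[cite: Arapura2005, main theorem (the Leray spectral sequence is compatible with mixed Hodge structures)]
[cite: Zucker1979, Hodge theory for variations of Hodge structure over curves] -/
def pencil_restrictCompl_eq_zero_of_forall_fiber_eq_zero : Prop :=
  ∀ ⦃n q : ℕ⦄ ⦃X : SchemeOver ℂ⦄, IsSmoothProjective n X →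
    ∀ (φ : X ⟶ projectiveSpace 1 ℂ) (S : Set (projectiveSpace 1 ℂ).left),
      IsClosed S → S.Nonempty → S ≠ Set.univ →
      (∀ t : ComplexPoints (projectiveSpace 1 ℂ), t.pt ∉ S →
        IsSmoothProjective (n - 1) (fiberOver φ t)) →
      (∀ t : ComplexPoints (projectiveSpace 1 ℂ), t.pt ∉ S →
        Function.Surjective (complexBetti.map (fiberι φ t) (2 * q - 1))) →
      ∀ δ : complexBetti X (2 * q),
        (∀ t : ComplexPoints (projectiveSpace 1 ℂ), t.pt ∉ S →
          complexBetti.map (fiberι φ t) (2 * q) δ = 0) →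
        complexBetti.restrictCompl X (φ.left.base ⁻¹' S) (2 * q) δ = 0

-- TODO(general form): any smooth projective family over a smooth AFFINE curve whose `R^{2q-1}` is a
-- constant variation of Hodge structure (or, over any affine curve, whose `H¹(V̄, j_*R^{2q-1})`
-- vanishes); stated for `X → ℙ¹` with the surjectivity criterion the consumer can verify.

end HodgeTheory

end Literature.AlgebraicGeometry.HodgeTheory

end
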